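import Literature.MathematicalPhysics.QuantumFieldTheory.Balaban1983to89.B5Eq112RenormTransf
import Literature.MathematicalPhysics.QuantumFieldTheory.BalabanImbrieJaffe1984to88.BIJ85Eq5113Proof
import Literature.MathematicalPhysics.QuantumFieldTheory.BalabanImbrieJaffe1984to88.BIJ85NoZeroModes309Torus

/-!
# `Balaban1983to89.B5Eq117CompositionV1` — T. Bałaban, *Propagators and renormalization transformations for lattice gauge
theories. I*, Commun. Math. Phys. **95** (1984) 17–40 [Balaban1984PropagatorsI]: the COMPOSITION LAW (1.16)–(1.17) p. 20 of the
renormalization transformations — `k` applications of `T` of (1.12) = ONE integral with `δ(B − Q_kA)δ_Ax(Q_{k−1}A)⋯δ_Ax(A)` — PROVED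
at measure level on the V1 lattice calculus, for the transformation of record `B5Eq112RenormTransf.renormTransf`

statement-level skeleton of published theorems with citation tags; proofs where landed; nothing here is a claim about the Yang–Mills mass gap

PDF held: `paper:balaban1984-cmp95-propagators-rt-i` (journal page = PDF page + 16); p. 20 [PDF 4] read for this file from the text
layer (`lit read … --pages 4`) and as an image from the ×2 render
`run/shared/lean/pub/pub-balaban/b2b-balaban-ref1/pages/1984-cmp95-propagators-rt-I/1984-cmp95-propagators-rt-I-p004-x2.png`.

PRINT, verbatim (p. 20, Sect. B "Compositions of Renormalization Transformations. Basic Sequence of Actions").  "We can apply the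
renormalization transformation again to (1.14). A composition of two transformations is easy to calculate:
`((ST)²e^{−S})(C) = z^{(2)}∫dB δ(C − QB)δ_Ax(B)∫dA δ(B − QA)δ_Ax(A)exp(−S_{L^{−1}}(A))`
`= z^{(2)}∫dA(∫dB δ(C − QB)δ(B − QA)δ_Ax(B))δ_Ax(A)exp(−S_{L^{−2}}(A)) = z^{(2)}∫dA δ(C − Q₂A)δ_Ax(QA)δ_Ax(A)exp(−S_{L^{−2}}(A))`, (1.16)
where `z^{(2)}` is a numerical factor coming from scaling transformations and `Q₂` is defined as `Q` only with the number `L` replaced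
by `L²` in all definitions. It is easily seen that a composition of `k` transformations is given by
`((ST)^k e^{−S})(B) = z^{(k)}∫dA δ(B − Q_kA)δ_Ax(Q_{k−1}A)·…·δ_Ax(A)e^{−S_η(A)}` (1.17)".

CITATION HEADER (lean-in-tree rule) — WHAT IS REPRODUCED.  Phase-2 proof file of the lit-balaban typed skeleton (HOME
`run/shared/lean/pub/lit-balaban/`), seat p38 (gen 2): SKELETON.md rows `B5.Eq1.16-1.19` (reader r18 knitting row: members (1.16),
(1.17); (1.18) = `B5Eq118OneStroke`, seat p39) and `B5.Eq1.17` (fold owner r02, whose TORUS-carrier statement/proof of record is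
`B5SectBStatements.Eq117` / `B5Eq114Gauss.eq117_holds`; this file is the V1-carrier TWIN announced as "V1↔Tor knitting open").
Everything is over the carriers OF RECORD of `LatticeFieldCalculus` (unit r18: the tori `Site P j`/`PBond P j` of `Setup`, `bondAvg`,
`bondAvgIter` = `Q_k`, `IsAxial` = `δ_Ax`) and the (1.12) transformation OF RECORD `B5Eq112RenormTransf.renormTransf` (seat p16:
`renormTransf S B = ∫_{fibre B} e^{−S}` = `B9Eq3166.subInt` over the affine fibre `{A axial, QA = B} = faceField B + axialKer`);
the `k`-fold constraint `δ_Ax(Q_{k−1}A)⋯δ_Ax(A)` and its null space are `BalabanImbrieJaffe1984to88.BIJ85AxialPropagator411.deltaAx` /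
`constraint411` (seat p09; BIJ85 (4.1.2) is this very product) and `BIJ85Eq5113Proof.bondAvgIter_sub`/`isAxial_sub` (seat p08), by name — nothing is re-declared.
TYPED READING (the cell's reading of δ-functions of LINEAR constraints, as in `B5Eq112RenormTransf`, `B9Eq3166`, `B9Eq3170`): the
right-hand side of (1.17) is the Lebesgue (surface-measure) integral of the density over the affine subspace
`{A : Q_kA = B, Q_jA axial ∀ j < k} = faceFieldIter k B + constraint411 k` (`multiRT`); the left-hand side `(ST)^k` is the `k`-fold ITERATE
of the one-step transformation (`rtPow`; the rescaling `S` is the relabelling `T^{(j)} → T^{(j+1)}` built into the levels of `Setup`).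
WHAT IS PROVED (kernel; standard axioms; standing range `k ≤ m + K` of `Setup.Params`): **(1.17)** `eq117`: for every `k` there is ONE
constant `z^{(k)} > 0` (independent of the density and of `B`) with `((ST)^k ρ)(B) = z^{(k)}·∫dA δ(B − Q_kA)δ_Ax(Q_{k−1}A)⋯δ_Ax(A)ρ(A)` for
every density `ρ` integrable on that fibre, in particular for `ρ = e^{−S}` (`eq117_exp`), and **(1.16)** (`eq116`, `k = 2`); the proof IS
the printed one: Fubini in the nested fibres ("`∫dB … ∫dA … = ∫dA(∫dB δ(C − QB)δ(B − QA)δ_Ax(B))…`") and the linear change of variables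
`(B-fibre coordinate, A-fibre coordinate) ↦ A` onto the two-fold fibre, whose constant Jacobian is `z` (Haar uniqueness,
`Measure.isAddLeftInvariant_eq_smul`; in print "a numerical factor coming from scaling transformations" — never evaluated there, not
evaluated here).  Supporting algebra PROVED: the iterated section `faceFieldIter` (`Q_k ∘ faceFieldIter k = id`, all intermediate
averages axial), the fibre of the `k`-fold δ's as a translate of `constraint411 k`, and the two-scale decomposition
`constraint411 (k+1) ≅ axialKer (level k) × constraint411 k`.
HYPOTHESIS DISPLAYED, not hidden: joint integrability of `ρ` on the `k`-fold fibre (the iterate is an iterated Bochner integral; for the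
printed `e^{−S}`, `S` = (1.3), it holds by the positivity of `⟨∂A, ∂A⟩` on the constraint subspace — rows B5.Claim@19 / BIJ85 p. 309, not
re-proved here).  DELIBERATELY NOT HERE: the Gaussian closed form (1.19) `= Z_{k,Ax}exp(−½⟨B, Δ_kB⟩)` and `Z_{k,Ax} = Z^{(k−1)}⋯Z^{(0)}`
(row B5.Eq1.19; torus version `B5Eq114Gauss.eq119_holds`).

Unit `lit-balaban-p38` (literature-prover-lit-balaban-p38-g2-0), 2026-08-21.

v1.1 (same day, append-only; + `import …BIJ85NoZeroModes309Torus`): §5 = the displayed integrability hypothesis DISCHARGED for the printed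
Gaussian density `e^{−S}`, `S` = the abelian action (1.3)/(1.5) `curlAction w c` (`w > 0`, `c ≠ 0`): `integrable_exp_neg_curlAction` (no zero
modes of `∂` on the constraint subspace — `BIJ85NoZeroModes309Torus.hD_holds`, seat p33 — plus completing the square,
`BIJ85AxialPropagator411.source_integrable`, seat p09), hence **(1.17)/(1.16) for the printed density with NO hypothesis**:
`eq117_curlAction`, `eq116_curlAction`.
-/

open scoped BigOperators NNReal

namespace Literature.MathematicalPhysics.QuantumFieldTheory.Balaban1983to89

namespace B5Eq117CompositionV1

open LatticeFieldCalculus MeasureTheory Matrix B5Eq112RenormTransf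
open B9Eq3166 (subInt)
open B9Eq3170 (IsBasisOf subInt_eq_of_isBasisOf gram_det_pos_of_injective)
open Literature.MathematicalPhysics.QuantumFieldTheory.BalabanImbrieJaffe1984to88.BIJ85AxialPropagator411
  (deltaAx deltaAx_zero deltaAx_succ constraint411 mem_constraint411 bondAvg_add bondAvg_smul bondAvgIter_add bondAvgIter_smul
    bondAvgIter_map_zero isAxial_add isAxial_smul isAxial_zero)
open Literature.MathematicalPhysics.QuantumFieldTheory.BalabanImbrieJaffe1984to88.BIJ85Eq5113Proof (bondAvgIter_sub isAxial_sub)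

/-! ## 1. The `k`-fold constraints `δ(B − Q_kA)δ_Ax(Q_{k−1}A)⋯δ_Ax(A)`: an explicit section and the fibres -/

section Algebra

variable {P : Params} {j : ℕ} {V : Type*} [AddCommGroup V] [Module ℝ V]

/-- The explicit axial representative of `B5Eq112RenormTransf` is additive in the coarse field. [cite: Balaban1984PropagatorsI, (1.12) p.19] -/
theorem faceField_add (B B' : VecField P (j + 1) V) : faceField (B + B') = faceField B + faceField B' := by
  funext b
  simp only [faceField, Pi.add_apply]
  split_ifs <;> simp [smul_add]

/-- … and homogeneous. [cite: Balaban1984PropagatorsI, (1.12) p.19] -/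
theorem faceField_smul (c : ℝ) (B : VecField P (j + 1) V) : faceField (c • B) = c • faceField B := by
  funext b
  simp only [faceField, Pi.smul_apply]
  split_ifs <;> simp [smul_comm c]

/-- THE ITERATED SECTION of the `k`-fold constraints of (1.17): `faceFieldIter k B` is the level-`0` field obtained from the level-`k` field
`B` by `k` applications of the one-step representative `faceField` (so that `Q_k(faceFieldIter k B) = B` and every intermediate average
`Q_j(faceFieldIter k B)`, `j < k`, is axial). [cite: Balaban1984PropagatorsI, (1.17) p.20] -/
def faceFieldIter : (k : ℕ) → VecField P k V → VecField P 0 V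
  | 0 => id
  | k + 1 => fun B => faceFieldIter k (faceField B)

/-- `faceFieldIter 0 = id`. [cite: Balaban1984PropagatorsI, (1.17) p.20] -/
theorem faceFieldIter_zero (A : VecField P 0 V) : faceFieldIter 0 A = A := rfl

/-- `faceFieldIter (k+1) B = faceFieldIter k (faceField B)`. [cite: Balaban1984PropagatorsI, (1.17) p.20] -/
theorem faceFieldIter_succ (k : ℕ) (B : VecField P (k + 1) V) : faceFieldIter (k + 1) B = faceFieldIter k (faceField B) := rfl

/-- The iterated section is additive. [cite: Balaban1984PropagatorsI, (1.17) p.20] -/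
theorem faceFieldIter_add : ∀ (k : ℕ) (B B' : VecField P k V), faceFieldIter (k := k) (B + B') = faceFieldIter k B + faceFieldIter k B'
  | 0, _, _ => rfl
  | k + 1, B, B' => by rw [faceFieldIter_succ, faceFieldIter_succ, faceFieldIter_succ, faceField_add, faceFieldIter_add k]

/-- The iterated section is homogeneous. [cite: Balaban1984PropagatorsI, (1.17) p.20] -/
theorem faceFieldIter_smul : ∀ (k : ℕ) (c : ℝ) (B : VecField P k V), faceFieldIter k (c • B) = c • faceFieldIter k B
  | 0, _, _ => rfl
  | k + 1, c, B => by rw [faceFieldIter_succ, faceFieldIter_succ, faceField_smul, faceFieldIter_smul k]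

/-- The iterated section is subtractive. [cite: Balaban1984PropagatorsI, (1.17) p.20] -/
theorem faceFieldIter_sub (k : ℕ) (B B' : VecField P k V) : faceFieldIter k (B - B') = faceFieldIter k B - faceFieldIter k B' := by
  rw [sub_eq_add_neg, faceFieldIter_add, ← neg_one_smul ℝ B', faceFieldIter_smul, neg_one_smul, ← sub_eq_add_neg]

/-- **`Q_k(faceFieldIter k B) = B`**: the iterated section is a right inverse of the `k`-fold average `Q_k` of (1.17)/(1.18) (standing
range `k ≤ m + K`). [cite: Balaban1984PropagatorsI, (1.17) p.20] -/
theorem bondAvgIter_faceFieldIter : ∀ {k : ℕ}, k ≤ P.m + P.K → ∀ B : VecField P k V, bondAvgIter k (faceFieldIter k B) = B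
  | 0, _, _ => rfl
  | k + 1, hk, B => by
    rw [faceFieldIter_succ, B5Eq120IterProof.bondAvgIter_succ, bondAvgIter_faceFieldIter (Nat.le_of_succ_le hk),
      bondAvg_faceField hk]

/-- **`δ_Ax(Q_{k−1}A)⋯δ_Ax(A)` holds at `A = faceFieldIter k B`**: every intermediate average of the iterated section is axial.
[cite: Balaban1984PropagatorsI, (1.17) p.20] -/
theorem deltaAx_faceFieldIter : ∀ {k : ℕ}, k ≤ P.m + P.K → ∀ B : VecField P k V, deltaAx k (faceFieldIter k B)
  | 0, _, B => deltaAx_zero _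
  | k + 1, hk, B => by
    rw [deltaAx_succ, faceFieldIter_succ, bondAvgIter_faceFieldIter (Nat.le_of_succ_le hk)]
    exact ⟨deltaAx_faceFieldIter (Nat.le_of_succ_le hk) _, isAxial_faceField hk B⟩

omit [Module ℝ V] in
/-- `δ_Ax` of a difference: if `A′` is axial then `A − A′` is axial iff `A` is. [cite: Balaban1984PropagatorsI, (1.10) p.19] -/
theorem isAxial_sub_iff {A A' : VecField P j V} (hA' : IsAxial A') : IsAxial (A - A') ↔ IsAxial A := by
  refine ⟨fun h => ?_, fun h => isAxial_sub h hA'⟩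
  have := isAxial_add h hA'
  rwa [sub_add_cancel] at this

/-- `δ_{k,Ax}` of a difference: if `A′` satisfies the `k`-fold axial gauge then `A − A′` does iff `A` does.
[cite: Balaban1984PropagatorsI, (1.17) p.20] -/
theorem deltaAx_sub_iff (k : ℕ) {A A' : VecField P 0 V} (hA' : deltaAx k A') : deltaAx k (A - A') ↔ deltaAx k A := by
  refine forall₂_congr fun i hi => ?_
  rw [bondAvgIter_sub]
  exact isAxial_sub_iff (hA' i hi)

/-- **The support of `δ(B − Q_kA)δ_Ax(Q_{k−1}A)⋯δ_Ax(A)`** in (1.17): the configurations with prescribed `k`-fold average `B` all of whose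
intermediate averages are axial. [cite: Balaban1984PropagatorsI, (1.17) p.20] -/
def fibreIter (k : ℕ) (B : VecField P k V) : Set (VecField P 0 V) := {A | deltaAx k A ∧ bondAvgIter k A = B}

/-- Membership in the `k`-fold fibre, unfolded. [cite: Balaban1984PropagatorsI, (1.17) p.20] -/
theorem mem_fibreIter (k : ℕ) (B : VecField P k V) (A : VecField P 0 V) : A ∈ fibreIter k B ↔ deltaAx k A ∧ bondAvgIter k A = B :=
  Iff.rfl

/-- The iterated section lies in the fibre: **the `k`-fold fibre is never empty**. [cite: Balaban1984PropagatorsI, (1.17) p.20] -/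
theorem faceFieldIter_mem_fibreIter {k : ℕ} (hk : k ≤ P.m + P.K) (B : VecField P k V) : faceFieldIter k B ∈ fibreIter k B :=
  ⟨deltaAx_faceFieldIter hk B, bondAvgIter_faceFieldIter hk B⟩

/-- **The `k`-fold fibre is the translate `faceFieldIter k B + constraint411 k`** of the null space of the constraints (BIJ85 (4.1.2):
`{Q_kA = 0, δ_{k,Ax}(A)}`). [cite: Balaban1984PropagatorsI, (1.17) p.20] -/
theorem mem_fibreIter_iff {k : ℕ} (hk : k ≤ P.m + P.K) (B : VecField P k V) (A : VecField P 0 V) :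
    A ∈ fibreIter k B ↔ A - faceFieldIter k B ∈ (constraint411 k : Submodule ℝ (VecField P 0 V)) := by
  rw [mem_fibreIter, mem_constraint411, bondAvgIter_sub, bondAvgIter_faceFieldIter hk, sub_eq_zero,
    deltaAx_sub_iff k (deltaAx_faceFieldIter hk B), and_comm]

/-- **Two-scale decomposition of the constraints** ("`δ(C − Q₂A)δ_Ax(QA)δ_Ax(A)` from `δ(C − QB)δ_Ax(B)` and `δ(B − QA)δ_Ax(A)`", (1.16)):
`A` lies in the null space of the `(k+1)`-fold constraints iff its `k`-fold average `Q_kA` lies in the one-step null space `{QB = 0, B axial}`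
of level `k` AND `A − faceFieldIter k (Q_kA)` lies in the null space of the `k`-fold constraints. [cite: Balaban1984PropagatorsI, (1.16) p.20] -/
theorem mem_constraint411_succ_iff {k : ℕ} (hk : k ≤ P.m + P.K) (A : VecField P 0 V) :
    A ∈ (constraint411 (k + 1) : Submodule ℝ (VecField P 0 V)) ↔
      bondAvgIter k A ∈ axialKer P k V ∧ A - faceFieldIter k (bondAvgIter k A) ∈ (constraint411 k : Submodule ℝ (VecField P 0 V)) := by
  rw [mem_constraint411, mem_constraint411, mem_axialKer_iff, deltaAx_succ, B5Eq120IterProof.bondAvgIter_succ, bondAvgIter_sub,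
    bondAvgIter_faceFieldIter hk, sub_self, deltaAx_sub_iff k (deltaAx_faceFieldIter hk _)]
  tauto

end Algebra

/-! ## 2. The two sides of (1.17) at measure level -/

section Integrals

variable {P : Params} {j : ℕ}

/-- The dimension of the null space `{Q_kA = 0, δ_{k,Ax}(A)}` of the `k`-fold constraints (the number of integration variables left by
the δ-functions of (1.17)). [cite: Balaban1984PropagatorsI, (1.17) p.20] -/
noncomputable def kerDimIter (P : Params) (k : ℕ) : ℕ :=
  Module.finrank ℝ (constraint411 k : Submodule ℝ (VecField P 0 ℝ))

/-- A basis matrix of the null space of the `k`-fold constraints (columns = a basis, as bond fields): the coordinates in which the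
right-hand side of (1.17) is written (any other basis gives the same integral, `multiRT_eq_subInt`). [cite: Balaban1984PropagatorsI, (1.17) p.20] -/
noncomputable def kerBasisIter (P : Params) (k : ℕ) : Matrix (PBond P 0) (Fin (kerDimIter P k)) ℝ :=
  Matrix.of fun b i =>
    ((Module.finBasis ℝ (constraint411 k : Submodule ℝ (VecField P 0 ℝ)) i : (constraint411 k : Submodule ℝ (VecField P 0 ℝ))) :
      VecField P 0 ℝ) b

/-- `N z = Σ_i z_i e_i`. [folklore] -/
private theorem kerBasisIter_mulVec (k : ℕ) (z : Fin (kerDimIter P k) → ℝ) :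
    kerBasisIter P k *ᵥ z =
      (((Module.finBasis ℝ (constraint411 k : Submodule ℝ (VecField P 0 ℝ))).equivFun.symm z :
        (constraint411 k : Submodule ℝ (VecField P 0 ℝ))) : VecField P 0 ℝ) := by
  funext b
  simp only [kerBasisIter, mulVec, dotProduct, Matrix.of_apply, Module.Basis.equivFun_symm_apply, Submodule.coe_sum,
    Submodule.coe_smul, Finset.sum_apply, Pi.smul_apply, smul_eq_mul]
  exact Finset.sum_congr rfl fun i _ => mul_comm _ _

/-- `kerBasisIter` IS a basis matrix of the null space of the `k`-fold constraints. [cite: Balaban1984PropagatorsI, (1.17) p.20] -/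
theorem isBasisOf_kerBasisIter (k : ℕ) :
    IsBasisOf (kerBasisIter P k) ((constraint411 k : Submodule ℝ (VecField P 0 ℝ)) : Set (VecField P 0 ℝ)) where
  inj := by
    intro z w h
    have h' : kerBasisIter P k *ᵥ z = kerBasisIter P k *ᵥ w := h
    rw [kerBasisIter_mulVec, kerBasisIter_mulVec] at h'
    exact (Module.finBasis ℝ _).equivFun.symm.injective (Subtype.ext h')
  range_eq := by
    ext A
    constructor
    · rintro ⟨z, rfl⟩
      show kerBasisIter P k *ᵥ z ∈ ((constraint411 k : Submodule ℝ (VecField P 0 ℝ)) : Set (VecField P 0 ℝ))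
      rw [kerBasisIter_mulVec]
      exact SetLike.coe_mem _
    · intro hA
      refine ⟨(Module.finBasis ℝ (constraint411 k : Submodule ℝ (VecField P 0 ℝ))).equivFun ⟨A, hA⟩, ?_⟩
      show kerBasisIter P k *ᵥ _ = A
      rw [kerBasisIter_mulVec, LinearEquiv.symm_apply_apply]

/-- THE ONE-STEP TRANSFORMATION IN DENSITY FORM: `(Tρ)(B) = ∫dA δ(B − QA)δ_Ax(A)ρ(A)` = the fibre integral of (1.12) applied to a density
`ρ` (so that `renormTransf S = rtDensity e^{−S}`, `renormTransf_eq_rtDensity`); this is the map that (1.16) composes.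
[cite: Balaban1984PropagatorsI, (1.12) p.19] -/
noncomputable def rtDensity (ρ : VecField P j ℝ → ℝ) (B : VecField P (j + 1) ℝ) : ℝ :=
  subInt (kerBasisMatrix P j) (fun A' => ρ (faceField B + A'))

/-- `(Te^{−S})` of (1.12) is `rtDensity` applied to the density `e^{−S}`. [cite: Balaban1984PropagatorsI, (1.12) p.19] -/
theorem renormTransf_eq_rtDensity (S : VecField P j ℝ → ℝ) : renormTransf S = rtDensity (fun A => Real.exp (-S A)) := rfl

/-- **`(ST)^k`**, the left-hand side of (1.17): the `k`-fold ITERATE of the one-step transformation, from densities on the level-`0` fields to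
functions of the level-`k` fields (the rescaling `S` is the relabelling of levels). [cite: Balaban1984PropagatorsI, (1.17) p.20] -/
noncomputable def rtPow : (k : ℕ) → (VecField P 0 ℝ → ℝ) → VecField P k ℝ → ℝ
  | 0, ρ => ρ
  | k + 1, ρ => rtDensity (rtPow k ρ)

/-- `(ST)^0 = id`. [cite: Balaban1984PropagatorsI, (1.17) p.20] -/
theorem rtPow_zero (ρ : VecField P 0 ℝ → ℝ) : rtPow 0 ρ = ρ := rfl

/-- `(ST)^{k+1} = (ST)∘(ST)^k`. [cite: Balaban1984PropagatorsI, (1.17) p.20] -/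
theorem rtPow_succ (k : ℕ) (ρ : VecField P 0 ℝ → ℝ) : rtPow (k + 1) ρ = rtDensity (rtPow k ρ) := rfl

/-- **The right-hand side of (1.17)** `∫dA δ(B − Q_kA)δ_Ax(Q_{k−1}A)⋯δ_Ax(A)ρ(A)` — typed reading: the Lebesgue (surface-measure) integral
of `ρ` over the affine fibre `faceFieldIter k B + constraint411 k`, `B9Eq3166.subInt` in the basis `kerBasisIter` (the print's normalisation
of the product of δ's differs by a constant depending on `d`, `L`, `|T|`, `k` only — part of `z^{(k)}`). [cite: Balaban1984PropagatorsI, (1.17) p.20] -/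
noncomputable def multiRT (k : ℕ) (ρ : VecField P 0 ℝ → ℝ) (B : VecField P k ℝ) : ℝ :=
  subInt (kerBasisIter P k) (fun A' => ρ (faceFieldIter k B + A'))

/-- BASIS INDEPENDENCE of the right-hand side of (1.17). [cite: Balaban1984PropagatorsI, (1.17) p.20] -/
theorem multiRT_eq_subInt {k : ℕ} {N : Matrix (PBond P 0) (Fin (kerDimIter P k)) ℝ}
    (hN : IsBasisOf N ((constraint411 k : Submodule ℝ (VecField P 0 ℝ)) : Set (VecField P 0 ℝ))) (ρ : VecField P 0 ℝ → ℝ)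
    (B : VecField P k ℝ) : multiRT k ρ B = subInt N (fun A' => ρ (faceFieldIter k B + A')) :=
  subInt_eq_of_isBasisOf (isBasisOf_kerBasisIter k) hN _

/-- REPRESENTATIVE INDEPENDENCE of the right-hand side of (1.17): the fibre integral may be based at ANY point of the `k`-fold fibre.
[cite: Balaban1984PropagatorsI, (1.17) p.20] -/
theorem multiRT_eq_of_mem_fibreIter {k : ℕ} (hk : k ≤ P.m + P.K) (ρ : VecField P 0 ℝ → ℝ) {B : VecField P k ℝ}
    {A₀ : VecField P 0 ℝ} (h₀ : A₀ ∈ fibreIter k B) :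
    multiRT k ρ B = subInt (kerBasisIter P k) (fun A' => ρ (A₀ + A')) := by
  have hmem := (mem_fibreIter_iff hk B A₀).mp h₀
  obtain ⟨z₀, hz₀⟩ := ((isBasisOf_kerBasisIter (P := P) k).mem_iff _).mp hmem
  unfold multiRT subInt
  congr 1
  have hfun : (fun z : Fin (kerDimIter P k) → ℝ => ρ (A₀ + kerBasisIter P k *ᵥ z))
      = fun z => ρ (faceFieldIter k B + kerBasisIter P k *ᵥ (z₀ + z)) := by
    funext z
    rw [mulVec_add, hz₀]
    congr 1
    abel
  rw [hfun]
  exact (integral_add_left_eq_self (μ := volume)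
    (fun z : Fin (kerDimIter P k) → ℝ => ρ (faceFieldIter k B + kerBasisIter P k *ᵥ z)) z₀).symm

end Integrals

/-! ## 3. The measure-theoretic core: a linear reparametrisation of a subspace has a constant Jacobian (Haar uniqueness) -/

section Jacobian

variable {n ι₁ ι₂ ι₃ : Type*} [Fintype ι₁] [Fintype ι₂] [Fintype ι₃]

/-- CONSTANT JACOBIAN OF A LINEAR REPARAMETRISATION ("`z^{(2)}` is a numerical factor"): if the linear map `Φ` of the product of two
coordinate spaces is injective with the same range as the injective matrix `N`, then `Φ = N ∘ e` for a linear isomorphism `e` onto the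
coordinate space of `N`, and `e` maps Lebesgue measure to a positive constant multiple of Lebesgue measure. [cite: Balaban1984PropagatorsI, (1.16) p.20] -/
theorem exists_equiv_map_volume (Φ : ((ι₁ → ℝ) × (ι₂ → ℝ)) →ₗ[ℝ] (n → ℝ)) (hΦ : Function.Injective Φ) (N : Matrix n ι₃ ℝ)
    (hN : Function.Injective N.mulVec) (hrange : Set.range N.mulVec = Set.range Φ) :
    ∃ e : ((ι₁ → ℝ) × (ι₂ → ℝ)) ≃L[ℝ] (ι₃ → ℝ), (∀ p, N *ᵥ e p = Φ p) ∧
      ∃ κ : ℝ≥0, 0 < κ ∧ Measure.map e volume = κ • (volume : Measure (ι₃ → ℝ)) := by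
  have hN' : Function.Injective N.mulVecLin := fun z w h => hN (by simpa using h)
  have hR : LinearMap.range Φ = LinearMap.range N.mulVecLin := by
    apply SetLike.coe_injective
    rw [LinearMap.coe_range, LinearMap.coe_range, ← hrange]
    ext A
    simp only [Set.mem_range, Matrix.mulVecLin_apply]
  let e₀ : ((ι₁ → ℝ) × (ι₂ → ℝ)) ≃ₗ[ℝ] (ι₃ → ℝ) :=
    (LinearEquiv.ofInjective Φ hΦ).trans ((LinearEquiv.ofEq _ _ hR).trans (LinearEquiv.ofInjective N.mulVecLin hN').symm)
  have he₀ : ∀ p, N *ᵥ e₀ p = Φ p := by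
    intro p
    have h1 : N.mulVecLin ((LinearEquiv.ofInjective N.mulVecLin hN').symm
        ((LinearEquiv.ofEq _ _ hR) (LinearEquiv.ofInjective Φ hΦ p))) =
        (((LinearEquiv.ofEq _ _ hR) (LinearEquiv.ofInjective Φ hΦ p)) : (n → ℝ)) := by
      rw [← LinearEquiv.ofInjective_apply (h := hN'), LinearEquiv.apply_symm_apply]
    rw [← Matrix.mulVecLin_apply]
    exact h1.trans (by simp)
  let e : ((ι₁ → ℝ) × (ι₂ → ℝ)) ≃L[ℝ] (ι₃ → ℝ) := e₀.toContinuousLinearEquiv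
  haveI iP : (volume : Measure ((ι₁ → ℝ) × (ι₂ → ℝ))).IsAddHaarMeasure := by
    rw [Measure.volume_eq_prod]; exact Measure.prod.instIsAddHaarMeasure _ _
  haveI : (Measure.map e (volume : Measure ((ι₁ → ℝ) × (ι₂ → ℝ)))).IsAddHaarMeasure := e.isAddHaarMeasure_map _
  refine ⟨e, he₀, Measure.addHaarScalarFactor (Measure.map e volume) volume,
    Measure.addHaarScalarFactor_pos_of_isAddHaarMeasure _ _, Measure.isAddLeftInvariant_eq_smul _ _⟩

/-- Consequences for integrals: the integral of `f ∘ Φ` over the product space is a constant multiple of the subspace integral of `f` in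
the basis `N` (no integrability needed: both sides are junk together), integrability transports, and — FUBINI — the iterated integral
equals the joint one for jointly integrable `f ∘ Φ`. [cite: Balaban1984PropagatorsI, (1.16) p.20] -/
theorem exists_const_integral_comp (Φ : ((ι₁ → ℝ) × (ι₂ → ℝ)) →ₗ[ℝ] (n → ℝ)) (hΦ : Function.Injective Φ) (N : Matrix n ι₃ ℝ)
    (hN : Function.Injective N.mulVec) (hrange : Set.range N.mulVec = Set.range Φ) :
    ∃ κ : ℝ, 0 < κ ∧ ∀ f : (n → ℝ) → ℝ,
      (∫ p : (ι₁ → ℝ) × (ι₂ → ℝ), f (Φ p) = κ * ∫ u : ι₃ → ℝ, f (N *ᵥ u)) ∧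
      (Integrable (fun u : ι₃ → ℝ => f (N *ᵥ u)) →
        Integrable (fun p : (ι₁ → ℝ) × (ι₂ → ℝ) => f (Φ p)) ∧
        (∀ᵐ t : ι₁ → ℝ, Integrable (fun s : ι₂ → ℝ => f (Φ (t, s)))) ∧
        ∫ t : ι₁ → ℝ, ∫ s : ι₂ → ℝ, f (Φ (t, s)) = κ * ∫ u : ι₃ → ℝ, f (N *ᵥ u)) := by
  obtain ⟨e, he, κ, hκ, hmap⟩ := exists_equiv_map_volume Φ hΦ N hN hrange
  have hme : MeasurableEmbedding (e : ((ι₁ → ℝ) × (ι₂ → ℝ)) → (ι₃ → ℝ)) := e.toHomeomorph.measurableEmbedding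
  refine ⟨(κ : ℝ), NNReal.coe_pos.2 hκ, fun f => ?_⟩
  have hcomp : (fun p : (ι₁ → ℝ) × (ι₂ → ℝ) => f (Φ p)) = (fun u : ι₃ → ℝ => f (N *ᵥ u)) ∘ e := by
    funext p; simp [he]
  have hint : ∫ p : (ι₁ → ℝ) × (ι₂ → ℝ), f (Φ p) = κ * ∫ u : ι₃ → ℝ, f (N *ᵥ u) := by
    have h := hme.integral_map (μ := volume) (fun u : ι₃ → ℝ => f (N *ᵥ u))
    simp only [he] at h
    rw [← h, hmap, integral_smul_nnreal_measure, NNReal.smul_def, smul_eq_mul]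
  refine ⟨hint, fun hf => ?_⟩
  have hF : Integrable (fun p : (ι₁ → ℝ) × (ι₂ → ℝ) => f (Φ p)) := by
    rw [hcomp, ← hme.integrable_map_iff, hmap]
    exact hf.smul_measure (by simp)
  have hF' : Integrable (fun p : (ι₁ → ℝ) × (ι₂ → ℝ) => f (Φ p)) ((volume : Measure (ι₁ → ℝ)).prod volume) := by
    rw [← Measure.volume_eq_prod]; exact hF
  refine ⟨hF, hF'.prod_right_ae, ?_⟩
  rw [← hint, Measure.volume_eq_prod, integral_prod _ hF']

end Jacobian

/-! ## 4. (1.16)–(1.17): the composition law -/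

section Composition

variable {P : Params}

/-- The linear map of the change of variables in (1.16): (coordinate `t` of the `B`-fibre at level `k`, coordinate `s` of the `k`-fold
`A`-fibre) ↦ `faceFieldIter k (N′t) + N_k s`, a point of the null space of the `(k+1)`-fold constraints. [cite: Balaban1984PropagatorsI, (1.16) p.20] -/
noncomputable def twoScaleMap (P : Params) (k : ℕ) :
    ((Fin (kerDim P k) → ℝ) × (Fin (kerDimIter P k) → ℝ)) →ₗ[ℝ] VecField P 0 ℝ where
  toFun p := faceFieldIter k (kerBasisMatrix P k *ᵥ p.1) + kerBasisIter P k *ᵥ p.2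
  map_add' p q := by
    simp only [Prod.fst_add, Prod.snd_add, mulVec_add, faceFieldIter_add]
    abel
  map_smul' c p := by
    simp only [Prod.smul_fst, Prod.smul_snd, mulVec_smul, faceFieldIter_smul, RingHom.id_apply, smul_add]

/-- `twoScaleMap` unfolded. [cite: Balaban1984PropagatorsI, (1.16) p.20] -/
theorem twoScaleMap_apply (k : ℕ) (p : (Fin (kerDim P k) → ℝ) × (Fin (kerDimIter P k) → ℝ)) :
    twoScaleMap P k p = faceFieldIter k (kerBasisMatrix P k *ᵥ p.1) + kerBasisIter P k *ᵥ p.2 := rfl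

/-- The change of variables of (1.16) is injective ("`δ(C − QB)δ(B − QA)`" determine `B` from `A`). [cite: Balaban1984PropagatorsI, (1.16) p.20] -/
theorem twoScaleMap_injective {k : ℕ} (hk : k ≤ P.m + P.K) : Function.Injective (twoScaleMap P k) := by
  rw [← LinearMap.ker_eq_bot, LinearMap.ker_eq_bot']
  intro p hp
  rw [twoScaleMap_apply] at hp
  have h1 : kerBasisMatrix P k *ᵥ p.1 = 0 := by
    have := congrArg (bondAvgIter k) hp
    rw [bondAvgIter_add, bondAvgIter_faceFieldIter hk, bondAvgIter_map_zero] at this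
    have hs : kerBasisIter P k *ᵥ p.2 ∈ ((constraint411 k : Submodule ℝ (VecField P 0 ℝ)) : Set (VecField P 0 ℝ)) :=
      ((isBasisOf_kerBasisIter (P := P) k).mem_iff _).mpr ⟨p.2, rfl⟩
    rw [SetLike.mem_coe, mem_constraint411] at hs
    rwa [hs.1, add_zero] at this
  have h2 : kerBasisIter P k *ᵥ p.2 = 0 := by
    rw [h1] at hp
    have h0 : faceFieldIter k (0 : VecField P k ℝ) = 0 := by
      have := faceFieldIter_smul (P := P) (V := ℝ) k 0 0
      simpa using this
    rwa [h0, zero_add] at hp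
  exact Prod.ext (isBasisOf_kerBasisMatrix.inj (by rw [h1, Prod.fst_zero, mulVec_zero]))
    ((isBasisOf_kerBasisIter k).inj (by rw [h2, Prod.snd_zero, mulVec_zero]))

/-- The change of variables of (1.16) is ONTO the null space of the `(k+1)`-fold constraints: its range is the range of the basis matrix
`kerBasisIter P (k+1)` (the two-scale decomposition `mem_constraint411_succ_iff`). [cite: Balaban1984PropagatorsI, (1.16) p.20] -/
theorem range_twoScaleMap {k : ℕ} (hk : k ≤ P.m + P.K) :
    Set.range (kerBasisIter P (k + 1)).mulVec = Set.range (twoScaleMap P k) := by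
  rw [(isBasisOf_kerBasisIter (P := P) (k + 1)).range_eq]
  ext A
  rw [SetLike.mem_coe, mem_constraint411_succ_iff hk, Set.mem_range]
  constructor
  · rintro ⟨h1, h2⟩
    obtain ⟨t, ht⟩ := (isBasisOf_kerBasisMatrix.mem_iff _).mp (show bondAvgIter k A ∈ (axialKer P k ℝ : Set _) from h1)
    obtain ⟨s, hs⟩ := ((isBasisOf_kerBasisIter (P := P) k).mem_iff _).mp
      (show A - faceFieldIter k (bondAvgIter k A) ∈ ((constraint411 k : Submodule ℝ (VecField P 0 ℝ)) : Set _) from h2)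
    refine ⟨(t, s), ?_⟩
    rw [twoScaleMap_apply, ht, hs]
    abel
  · rintro ⟨p, rfl⟩
    rw [twoScaleMap_apply]
    have ht : kerBasisMatrix P k *ᵥ p.1 ∈ (axialKer P k ℝ : Set (VecField P k ℝ)) :=
      (isBasisOf_kerBasisMatrix.mem_iff _).mpr ⟨p.1, rfl⟩
    have hs : kerBasisIter P k *ᵥ p.2 ∈ ((constraint411 k : Submodule ℝ (VecField P 0 ℝ)) : Set (VecField P 0 ℝ)) :=
      ((isBasisOf_kerBasisIter (P := P) k).mem_iff _).mpr ⟨p.2, rfl⟩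
    rw [SetLike.mem_coe, mem_constraint411] at hs
    have hQ : bondAvgIter k (faceFieldIter k (kerBasisMatrix P k *ᵥ p.1) + kerBasisIter P k *ᵥ p.2) = kerBasisMatrix P k *ᵥ p.1 := by
      rw [bondAvgIter_add, bondAvgIter_faceFieldIter hk, hs.1, add_zero]
    rw [hQ]
    refine ⟨ht, ?_⟩
    rw [add_sub_cancel_left, mem_constraint411]
    exact hs

/-- **THE INDUCTIVE STEP OF (1.17)** ("It is easily seen that a composition of `k` transformations is given by …"): one more application of `T`
to the `k`-fold fibre integral is the `(k+1)`-fold fibre integral, up to ONE positive constant `κ_k` (independent of the density and of the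
field); with the a.e. integrability of the sections needed to iterate. [cite: Balaban1984PropagatorsI, (1.17) p.20] -/
theorem rtDensity_multiRT {k : ℕ} (hk : k + 1 ≤ P.m + P.K) :
    ∃ κ : ℝ, 0 < κ ∧ ∀ (ρ : VecField P 0 ℝ → ℝ) (C : VecField P (k + 1) ℝ),
      Integrable (fun u : Fin (kerDimIter P (k + 1)) → ℝ => ρ (faceFieldIter (k + 1) C + kerBasisIter P (k + 1) *ᵥ u)) →
        (∀ᵐ t : Fin (kerDim P k) → ℝ, Integrable (fun s : Fin (kerDimIter P k) → ℝ =>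
          ρ (faceFieldIter k (faceField C + kerBasisMatrix P k *ᵥ t) + kerBasisIter P k *ᵥ s))) ∧
        rtDensity (multiRT k ρ) C = κ * multiRT (k + 1) ρ C := by
  have hk' : k ≤ P.m + P.K := Nat.le_of_succ_le hk
  obtain ⟨κ, hκ, hall⟩ := exists_const_integral_comp (twoScaleMap P k) (twoScaleMap_injective hk') (kerBasisIter P (k + 1))
    (isBasisOf_kerBasisIter (k + 1)).inj (range_twoScaleMap hk')
  -- the Gram factors of the three bases
  set g' : ℝ := Real.sqrt (((kerBasisMatrix P k)ᵀ * kerBasisMatrix P k).det) with hg'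
  set gk : ℝ := Real.sqrt (((kerBasisIter P k)ᵀ * kerBasisIter P k).det) with hgk
  set gs : ℝ := Real.sqrt (((kerBasisIter P (k + 1))ᵀ * kerBasisIter P (k + 1)).det) with hgs
  have hg'pos : 0 < g' := Real.sqrt_pos.2 (gram_det_pos_of_injective _ isBasisOf_kerBasisMatrix.inj)
  have hgkpos : 0 < gk := Real.sqrt_pos.2 (gram_det_pos_of_injective _ (isBasisOf_kerBasisIter k).inj)
  have hgspos : 0 < gs := Real.sqrt_pos.2 (gram_det_pos_of_injective _ (isBasisOf_kerBasisIter (k + 1)).inj)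
  refine ⟨g' * gk * κ / gs, by positivity, fun ρ C hρ => ?_⟩
  -- the integrand in the two-scale coordinates
  set f : VecField P 0 ℝ → ℝ := fun A' => ρ (faceFieldIter (k + 1) C + A') with hf
  have hsec : ∀ (t : Fin (kerDim P k) → ℝ) (s : Fin (kerDimIter P k) → ℝ),
      ρ (faceFieldIter k (faceField C + kerBasisMatrix P k *ᵥ t) + kerBasisIter P k *ᵥ s) = f (twoScaleMap P k (t, s)) := by
    intro t s
    simp only [hf, twoScaleMap_apply, faceFieldIter_succ, faceFieldIter_add]
    congr 1
    abel
  obtain ⟨hF, hae, hfub⟩ := (hall f).2 hρ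
  refine ⟨hae.mono fun t ht => by simpa only [hsec] using ht, ?_⟩
  -- unfold both sides
  have lhs : rtDensity (multiRT k ρ) C = g' * ∫ t : Fin (kerDim P k) → ℝ, gk * ∫ s : Fin (kerDimIter P k) → ℝ,
      f (twoScaleMap P k (t, s)) := by
    simp only [rtDensity, multiRT, subInt, ← hg', ← hgk, hsec]
  rw [lhs, integral_const_mul, hfub]
  simp only [multiRT, subInt, ← hgs, hf]
  field_simp

/-- The base of the induction: with no constraint level the fibre integral is evaluation (`Q_0 = 1`, empty product of δ's; the null space
of the `0`-fold constraints is `{0}`). [cite: Balaban1984PropagatorsI, (1.17) p.20] -/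
theorem multiRT_zero (ρ : VecField P 0 ℝ → ℝ) (B : VecField P 0 ℝ) : multiRT 0 ρ B = ρ B := by
  have hN := isBasisOf_kerBasisIter (P := P) 0
  -- the null space of the 0-fold constraints is `{0}`, so its basis has no columns
  have hzero : ∀ z : Fin (kerDimIter P 0) → ℝ, kerBasisIter P 0 *ᵥ z = 0 := by
    intro z
    have hz : kerBasisIter P 0 *ᵥ z ∈ ((constraint411 0 : Submodule ℝ (VecField P 0 ℝ)) : Set (VecField P 0 ℝ)) :=
      (hN.mem_iff _).mpr ⟨z, rfl⟩
    rw [SetLike.mem_coe, mem_constraint411] at hz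
    exact hz.1
  haveI : IsEmpty (Fin (kerDimIter P 0)) := by
    refine ⟨fun i => ?_⟩
    have h := hN.inj (a₁ := Pi.single i 1) (a₂ := 0) (by rw [hzero, hzero])
    have := congrFun h i
    simp at this
  have hdet : ((kerBasisIter P 0)ᵀ * kerBasisIter P 0).det = 1 := Matrix.det_isEmpty
  unfold multiRT subInt
  rw [hdet, Real.sqrt_one, one_mul]
  simp only [hzero, add_zero, faceFieldIter_zero]
  rw [integral_const, smul_eq_mul]
  have : (volume : Measure (Fin (kerDimIter P 0) → ℝ)) Set.univ = 1 := by
    rw [volume_pi, Measure.pi_of_empty]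
    simp
  rw [measureReal_def, this, ENNReal.toReal_one, one_mul]

/-- **(1.17)** p. 20 [PDF 4], verbatim: *"It is easily seen that a composition of `k` transformations is given by
`((ST)^k e^{−S})(B) = z^{(k)}∫dA δ(B − Q_kA)δ_Ax(Q_{k−1}A)·…·δ_Ax(A)e^{−S_η(A)}` (1.17)"* — for densities: in the standing range `k ≤ m + K` there is
ONE constant `z^{(k)} > 0` such that for every density `ρ` on the level-`0` fields and every level-`k` field `B` with `ρ` integrable on the
`k`-fold fibre over `B` (coordinates `kerBasisIter`), the `k`-fold iterate of the transformation (1.12) equals `z^{(k)}` times the fibre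
integral with the `k`-fold constraints. [cite: Balaban1984PropagatorsI, (1.17) p.20] -/
theorem eq117 : ∀ {k : ℕ}, k ≤ P.m + P.K → ∃ z : ℝ, 0 < z ∧ ∀ (ρ : VecField P 0 ℝ → ℝ) (B : VecField P k ℝ),
    Integrable (fun u : Fin (kerDimIter P k) → ℝ => ρ (faceFieldIter k B + kerBasisIter P k *ᵥ u)) →
      rtPow k ρ B = z * multiRT k ρ B
  | 0, _ => ⟨1, one_pos, fun ρ B _ => by rw [rtPow_zero, multiRT_zero, one_mul]⟩
  | k + 1, hk => by
    obtain ⟨z, hz, hzk⟩ := eq117 (Nat.le_of_succ_le hk)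
    obtain ⟨κ, hκ, hstep⟩ := rtDensity_multiRT (P := P) hk
    refine ⟨z * κ, mul_pos hz hκ, fun ρ C hρ => ?_⟩
    obtain ⟨hae, heq⟩ := hstep ρ C hρ
    rw [rtPow_succ]
    -- under the outer fibre integral, replace `(ST)^k ρ` by `z · multiRT k ρ` (a.e. in the fibre coordinate, by the induction hypothesis)
    have hcongr : rtDensity (rtPow k ρ) C = z * rtDensity (multiRT k ρ) C := by
      simp only [rtDensity, subInt]
      rw [mul_left_comm]
      congr 1
      rw [← integral_const_mul]
      exact integral_congr_ae (hae.mono fun t ht => hzk ρ _ ht)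
    rw [hcongr, heq, mul_assoc]

/-- **(1.17) for the transformation `(Te^{−S})` of (1.12)**: `k` applications of `renormTransf` to `e^{−S}` equal `z^{(k)}` times the integral
`∫dA δ(B − Q_kA)δ_Ax(Q_{k−1}A)⋯δ_Ax(A)e^{−S(A)}`, for every action `S` with `e^{−S}` integrable on the `k`-fold fibre (for the printed abelian
action (1.3) this is the positivity of `⟨∂A, ∂A⟩` on the constraint subspace, p. 19 / BIJ85 p. 309). [cite: Balaban1984PropagatorsI, (1.17) p.20] -/
theorem eq117_exp {k : ℕ} (hk : k ≤ P.m + P.K) : ∃ z : ℝ, 0 < z ∧ ∀ (S : VecField P 0 ℝ → ℝ) (B : VecField P k ℝ),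
    Integrable (fun u : Fin (kerDimIter P k) → ℝ => Real.exp (-S (faceFieldIter k B + kerBasisIter P k *ᵥ u))) →
      rtPow k (fun A => Real.exp (-S A)) B = z * multiRT k (fun A => Real.exp (-S A)) B := by
  obtain ⟨z, hz, h⟩ := eq117 (P := P) hk
  exact ⟨z, hz, fun S B hS => h _ B hS⟩

/-- `(ST)¹ = T`: one application is the transformation (1.12) itself. [cite: Balaban1984PropagatorsI, (1.16) p.20] -/
theorem rtPow_one (S : VecField P 0 ℝ → ℝ) : rtPow 1 (fun A => Real.exp (-S A)) = renormTransf S := rfl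

/-- **(1.16)** p. 20 [PDF 4], verbatim: *"A composition of two transformations is easy to calculate:
`((ST)²e^{−S})(C) = z^{(2)}∫dB δ(C − QB)δ_Ax(B)∫dA δ(B − QA)δ_Ax(A)exp(−S(A)) = … = z^{(2)}∫dA δ(C − Q₂A)δ_Ax(QA)δ_Ax(A)exp(−S(A))`, (1.16)"* —
`T` of (1.12) applied to the function `B ↦ (Te^{−S})(B)` equals `z^{(2)}` times the integral with the two-fold constraints
`δ(C − Q₂A)δ_Ax(QA)δ_Ax(A)` (`Q₂ = Q∘Q = bondAvgIter 2`), one constant for all `S` and `C` (integrability of `e^{−S}` on the two-fold fibre displayed).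
[cite: Balaban1984PropagatorsI, (1.16) p.20] -/
theorem eq116 (h2 : 2 ≤ P.m + P.K) : ∃ z : ℝ, 0 < z ∧ ∀ (S : VecField P 0 ℝ → ℝ) (C : VecField P 2 ℝ),
    Integrable (fun u : Fin (kerDimIter P 2) → ℝ => Real.exp (-S (faceFieldIter 2 C + kerBasisIter P 2 *ᵥ u))) →
      rtDensity (renormTransf S) C = z * multiRT 2 (fun A => Real.exp (-S A)) C :=
  eq117_exp (P := P) h2

end Composition

/-! ## 5. v1.1 (append-only): (1.17) UNCONDITIONALLY for the printed Gaussian density `e^{−S}`, `S` = the abelian action (1.3)/(1.5)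
(the displayed integrability hypothesis DISCHARGED by the absence of zero modes of `∂` on the constraint subspace — the V1 torus theorem
`BalabanImbrieJaffe1984to88.BIJ85NoZeroModes309Torus.hD_holds` of seat p33, by name) -/

section Gaussian

variable {P : Params}

open Literature.MathematicalPhysics.QuantumFieldTheory.BalabanImbrieJaffe1984to88.BIJ85NoZeroModes309Torus (hD_holds)
open Literature.MathematicalPhysics.QuantumFieldTheory.BalabanImbrieJaffe1984to88.BIJ85AxialPropagator411
  (PlaqSpace toE curlOp half_norm_curlOp_sq source_integrable)
open scoped RealInnerProductSpace

/-- **INTEGRABILITY OF THE PRINTED DENSITY ON EVERY `k`-FOLD FIBRE** (p. 19: *"The integral in (1.12) is obviously a Gaussian integral. We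
will prove later that the quadratic form `⟨∂A, ∂A⟩` is positive on the subspace of `A` satisfying `QA = 0`, `A(Γ_{y,x}) = 0`"*; BIJ85 p. 309
*"Such zero modes do not occur, and as a consequence the integral (4.1.1) is convergent"*): for the abelian action `S(A) = ½Σ_p w|(∂A)(p)|²`
(`curlAction w c`, `w > 0`, lattice factor `c ≠ 0`) and every base point `A₀`, `u ↦ e^{−S(A₀ + N_k u)}` is integrable over the coordinates
of the null space of the `k`-fold constraints — `∂` has no zero modes there (`BIJ85NoZeroModes309Torus.hD_holds`), so the exponent is a
positive-definite quadratic form plus a linear term (`BIJ85AxialPropagator411.source_integrable`). [cite: Balaban1984PropagatorsI, (1.12) p.19] -/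
theorem integrable_exp_neg_curlAction {k : ℕ} (hk : k ≤ P.m + P.K) {w : ℝ} (hw : 0 < w) {c : ℝ} (hc : c ≠ 0) (A₀ : VecField P 0 ℝ) :
    Integrable (fun u : Fin (kerDimIter P k) → ℝ => Real.exp (-curlAction w c (A₀ + kerBasisIter P k *ᵥ u))) := by
  -- Euclidean coordinates `W` of the null space and the map `S u = √w·∂(N u)` into the Euclidean plaquette space
  let W : Type := EuclideanSpace ℝ (Fin (kerDimIter P k))
  let ι : W →ₗ[ℝ] VecField P 0 ℝ :=
    (kerBasisIter P k).mulVecLin ∘ₗ (WithLp.linearEquiv 2 ℝ (Fin (kerDimIter P k) → ℝ)).toLinearMap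
  have hι : ∀ u : W, ι u = kerBasisIter P k *ᵥ (WithLp.ofLp u) := fun u => rfl
  let S : W →ₗ[ℝ] PlaqSpace P := curlOp (P := P) w c ∘ₗ (toE P).toLinearMap ∘ₗ ι
  have hS_apply : ∀ (u : W) (p : Plaq P 0), S u p = Real.sqrt w * curl c (ι u) p := by
    intro u p
    show curlOp (P := P) w c (toE P (ι u)) p = _
    rw [show curlOp (P := P) w c (toE P (ι u)) p = Real.sqrt w * curl c ((toE P).symm (toE P (ι u))) p from rfl,
      LinearEquiv.symm_apply_apply]
  -- no zero modes ⇒ `S` injective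
  have hS : Function.Injective S := by
    rw [← LinearMap.ker_eq_bot, LinearMap.ker_eq_bot']
    intro u hu
    have hcurl : ∀ p, curl c (ι u) p = 0 := by
      intro p
      have h := congrArg (fun v : PlaqSpace P => v p) hu
      simp only [hS_apply] at h
      have hsw : Real.sqrt w ≠ 0 := (Real.sqrt_pos.2 hw).ne'
      simpa [hsw] using h
    have hmem : ι u ∈ (constraint411 k : Submodule ℝ (VecField P 0 ℝ)) := by
      rw [hι, ← SetLike.mem_coe]
      exact ((isBasisOf_kerBasisIter (P := P) k).mem_iff _).mpr ⟨_, rfl⟩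
    have h0 : ι u = 0 := hD_holds hk hc _ hmem hcurl
    rw [hι] at h0
    have h1 : WithLp.ofLp u = 0 := (isBasisOf_kerBasisIter (P := P) k).inj (by rw [h0, mulVec_zero])
    have h2 := congrArg (WithLp.toLp 2) h1
    simpa using h2
  -- the exponent is `½‖S u + s₀‖²`
  set s₀ : PlaqSpace P := curlOp (P := P) w c (toE P A₀) with hs₀
  have hexp : ∀ u : W, curlAction w c (A₀ + kerBasisIter P k *ᵥ WithLp.ofLp u) = (1 / 2) * ‖S u + s₀‖ ^ 2 := by
    intro u
    have h1 : S u + s₀ = curlOp (P := P) w c (toE P (A₀ + ι u)) := by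
      show curlOp (P := P) w c (toE P (ι u)) + curlOp (P := P) w c (toE P A₀) = _
      rw [← map_add, ← map_add, add_comm]
    rw [h1, half_norm_curlOp_sq hw.le, LinearEquiv.symm_apply_apply, hι]
  -- complete the square against the source `b = −S†s₀`
  have hsq : ∀ u : W, Real.exp (-curlAction w c (A₀ + kerBasisIter P k *ᵥ WithLp.ofLp u)) =
      Real.exp (-(1 / 2) * ‖s₀‖ ^ 2) * Real.exp (-(1 / 2) * ‖S u‖ ^ 2 + ⟪u, -(LinearMap.adjoint S s₀)⟫) := by
    intro u
    rw [hexp, ← Real.exp_add, norm_add_sq_real, inner_neg_right, LinearMap.adjoint_inner_right]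
    congr 1
    ring
  have hW : Integrable (fun u : W => Real.exp (-curlAction w c (A₀ + kerBasisIter P k *ᵥ WithLp.ofLp u))) := by
    simp_rw [hsq]
    exact (source_integrable hS _).const_mul _
  -- transfer from the Euclidean coordinates to `Fin n → ℝ` (the identification is volume preserving)
  have hmp := EuclideanSpace.volume_preserving_symm_measurableEquiv_toLp (Fin (kerDimIter P k))
  exact (hmp.integrable_comp_emb (MeasurableEquiv.toLp 2 (Fin (kerDimIter P k) → ℝ)).symm.measurableEmbedding).1 hW

/-- **(1.17) for the printed density, no hypothesis left**: for the abelian action `S = ½Σ_p w|(∂A)(p)|²` (`w > 0`, `c ≠ 0`) and every `k` in the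
standing range there is ONE `z^{(k)} > 0` with `((ST)^k e^{−S})(B) = z^{(k)}∫dA δ(B − Q_kA)δ_Ax(Q_{k−1}A)⋯δ_Ax(A)e^{−S(A)}` for EVERY `B`.
[cite: Balaban1984PropagatorsI, (1.17) p.20] -/
theorem eq117_curlAction {k : ℕ} (hk : k ≤ P.m + P.K) {w : ℝ} (hw : 0 < w) {c : ℝ} (hc : c ≠ 0) :
    ∃ z : ℝ, 0 < z ∧ ∀ B : VecField P k ℝ,
      rtPow k (fun A => Real.exp (-curlAction w c A)) B = z * multiRT k (fun A => Real.exp (-curlAction w c A)) B := by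
  obtain ⟨z, hz, h⟩ := eq117_exp (P := P) hk
  exact ⟨z, hz, fun B => h _ B (integrable_exp_neg_curlAction hk hw hc _)⟩

/-- **(1.16) for the printed density, no hypothesis left**: `T` of (1.12) applied to `B ↦ (Te^{−S})(B)` is `z^{(2)}` times the integral with the
constraints `δ(C − Q₂A)δ_Ax(QA)δ_Ax(A)`, for the abelian action `S` and every `C`. [cite: Balaban1984PropagatorsI, (1.16) p.20] -/
theorem eq116_curlAction (h2 : 2 ≤ P.m + P.K) {w : ℝ} (hw : 0 < w) {c : ℝ} (hc : c ≠ 0) :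
    ∃ z : ℝ, 0 < z ∧ ∀ C : VecField P 2 ℝ,
      rtDensity (renormTransf (curlAction w c)) C = z * multiRT 2 (fun A => Real.exp (-curlAction w c A)) C :=
  eq117_curlAction (P := P) h2 hw hc

end Gaussian

end B5Eq117CompositionV1

end Literature.MathematicalPhysics.QuantumFieldTheory.Balaban1983to89
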